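import Summits.AtomisticToContinuum.BoseEinsteinCondensation.Theorems.BECCutLineWeakDisorderAcrossCutCompose
import Summits.AtomisticToContinuum.BoseEinsteinCondensation.Theorems.BECCutLineWeakDisorderAcrossCutBlockOfCovariance
import Summits.AtomisticToContinuum.BoseEinsteinCondensation.Theorems.BECCutLineWeakDisorderAcrossCutKineticFlatnessFreeGas
import Summits.AtomisticToContinuum.BoseEinsteinCondensation.Theorems.BECCutLineWeakDisorderAcrossCutParticipationTailFreeGas
import Summits.AtomisticToContinuum.BoseEinsteinCondensation.Theorems.TwoReplicaTransienceBound.Negative.ConstantAtLeastOne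
import HarnessLib
import HarnessLib.Audit

/-!
# Crux `TwoReplicaTransienceBound` (stmt-AtomisticToContinuum-9687) — CHECKED SKELETON of the line
# `across-cut-thinning`, v3 (lead c6, end of cycle 1): everything provable has LANDED

Vocabulary + stub statements: `Theorems/BECCutLineWeakDisorderAcrossCutDefs.lean` (p136563, append p137814).
Composition (sorry-free, registered bookkeeping stub `stub_acrossCutCompose`):
`Theorems/BECCutLineWeakDisorderAcrossCutCompose.lean` (+ `…ComposeIR.lean`, `…Bookkeeping.lean`).

LANDED registered stubs of the line (theorems of the tree, used below BY NAME):
* `stub_tiltFTC` — THE DEVICE (`…AcrossCutTiltFTC.lean`, p137194): `∂ₛ∂ₜ log Λ = Cov`, a tilted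
  covariance bound closes the connected across-cut functional at all orders;
* `stub_blockOfCovariance` (`…AcrossCutBlockOfCovariance.lean`, p137921 = `stub_blockOfFourPoint`
  (`…AcrossCutBlock.lean`) ∘ `stub_fourPointOfTilt` (`…AcrossCutFourPoint.lean`, realisation
  `stub_tiltRealisation` of `…AcrossCutTwoSided.lean`)): for bounded `v`, the tilt-uniform covariance
  bound ⇒ the annealed kinetic-block two-replica bound (four-point inequality + Tonelli through the tracer).
Calibration rows landed (v ≡ 0 / FK-free): `stub_kineticScaleFlatnessBeyondFreeGas` (p137195),
`stub_meanProfileFlatFreeGas` (p137159), `stub_participationTailFreeGas` (p137284, equality C₂ = 1),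
`stub_blockTwoReplicaFree` (p137679, equality c = 1), `stub_crossTiltLe` (p137108, finiteness).

OPEN registered stubs (the five `sorry`s below) = the CONJECTURE INPUTS of the line, each typed once,
audited (work/stubs/*.md of the lead's folder: no junk, no cheap kill) and free-gas calibrated; all are
BEC-strength / unpublished (workers' `stub-blocked` verdicts name no existing tree fact):
`stub_crossCovarianceBdd` (bounded `v`: tilt-uniform across-cut dose covariance, (H-IR) type),
`stub_blockTwoReplicaUnbounded` (`v` unbounded on `[0,∞)`: block two-replica bound typed directly —
hard-sphere BEC strength), `stub_meanProfileFlat` (wall layer of the one-point insertion profile),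
`stub_participationTail` (reverse Hölder of the across-block participation under the broken-line law),
`stub_kineticScaleFlatnessBeyond` (= `TaggedShiftLogHarnack.KineticScaleFlatnessBeyond`, the shared UV
module; lead a1's F4 obstacle applies).

Disproof.lean (cdisprove c1, unchanged since 2026-08-16T11:34Z): no `_false_without_` theorem, no
`-- Targets` kill on these stubs; `Negative/ConstantAtLeastOne` (C ≥ 1) imported and compatible
(composition constant `max (…) 20`).
-/

noncomputable section

open MeasureTheory Filter Set Finset
open scoped ENNReal NNReal Topology BigOperators

namespace Summit.AtomisticToContinuum.BoseEinsteinCondensation.Cruxes.TwoReplicaTransienceBound.AcrossCutThinning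

open Literature.MathematicalPhysics.QuantumManyBody.BoseGas
open Summit.AtomisticToContinuum.BoseEinsteinCondensation.Theses.BECCutLineWeakDisorder

/-! ### The open stubs (sorried; the conjecture inputs of the line) -/

/-- STUB (OPEN; the conjecture ITEM for bounded `v`, BEC-strength). -/
theorem stub_crossCovarianceBdd : Goal.stub_crossCovarianceBdd := by
  sorry

/-- STUB (OPEN; the conjecture input for `v` unbounded on `[0,∞)`, hard-sphere BEC strength). -/
theorem stub_blockTwoReplicaUnbounded : Goal.stub_blockTwoReplicaUnbounded := by
  sorry

/-- STUB (OPEN; module: the mean insertion profile is spread over the box). -/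
theorem stub_meanProfileFlat : Goal.stub_meanProfileFlat := by
  sorry

/-- STUB (OPEN; module: reverse Hölder of the across-block participation under the broken-line law). -/
theorem stub_participationTail : Goal.stub_participationTail := by
  sorry

/-- STUB (OPEN; the shared UV module = `TaggedShiftLogHarnack.KineticScaleFlatnessBeyond`). -/
theorem stub_kineticScaleFlatnessBeyond : Goal.stub_kineticScaleFlatnessBeyond := by
  sorry

/-! ### The skeleton -/

/-- The skeleton: the crux BY NAME from the two LANDED stubs and the five sorried conjecture inputs. -/
theorem twoReplicaTransienceBound_skeleton : TwoReplicaTransienceBound :=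
  TwoReplicaTransienceBound_of stub_tiltFTC stub_blockOfCovariance stub_crossCovarianceBdd
    stub_blockTwoReplicaUnbounded stub_meanProfileFlat stub_participationTail
    stub_kineticScaleFlatnessBeyond

/-! ### Sanity: landed stubs, calibration rows and the negative lemma are in scope -/

example := @stub_tiltFTC
example := @stub_blockOfCovariance
example := @blockOfCovarianceReduction
example := @stub_kineticScaleFlatnessBeyondFreeGas
example := @stub_participationTailFreeGas
example := @stub_blockTwoReplicaFree
example := @stub_meanProfileFlatFreeGas
example := @Summit.AtomisticToContinuum.BoseEinsteinCondensation.Theorems.TwoReplicaTransienceBound.Negative.not_twoReplicaTransienceBound_below_one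

end Summit.AtomisticToContinuum.BoseEinsteinCondensation.Cruxes.TwoReplicaTransienceBound.AcrossCutThinning

end
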